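import Mathlib
import Literature.GroupTheory.CombinatorialGroupTheory.SignedHurwitzAction
import Literature.GroupTheory.CombinatorialGroupTheory.SignedHurwitzStabilisation
import HarnessLib

/-!
# The exchange move on integral signed words: stabilise once, tilt twice

Companion to `SignedHurwitzAction.lean` / `SignedHurwitzStabilisation.lean` (signed Hurwitz
moves, stabilisation-pair moves `StabStep`, reachability `Reach` on integral signed words
`IntWord g`, letters in `ℤ^{2g}` with the standard symplectic pairing `stdSymp ℤ g`).  This file
records the algebra of ONE EXCHANGE (the homological shadow of: stabilise the bisected achiral
Lefschetz fibration by a common positive stabilisation pair whose arc class `c` links both a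
negative letter `w` and a positive letter `y` adjacent to the cut, then re-choose two arcs):
* §1 integral spans pass to rational spans of the rational images (`ratCast_mem_span`);
* §2 the standard symplectic lattice: alternating, skew, values on coordinate vectors, and the
  choice of a PRIMITIVE `c` with `ω(c, x) ≠ 0 ≠ ω(c, y)` for any two non-zero `x, y`
  (a coordinate vector or a sum of two);
* §3 `reach_exchange`: from `A ++ w :: y :: C` one stabilisation-pair move at the cut
  `A ++ [w] ‖ y :: C` followed by the two Hurwitz moves `(w)(e + c)⁺ ↦ (e + c ± ω(w,c) w)⁺ (w)`
  and `(e + c)⁻ (y) ↦ (y - ω(c,y)(e + c)) (e + c)⁻` reaches an explicit word of genus `g + 1`;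
* §4 the rational genus-raising embedding `ℚ^{2g} → ℚ^{2g+2}` (Mathlib's
  `Function.ExtendByZero.linearMap` along `Sum.map Fin.castSucc Fin.castSucc`): coordinates,
  compatibility with `embed`, injectivity, and the decomposition `x = ι x₀ + x_e e + x_f f`;
* §5 two rank statements in `ℚ^{2g+2}`: a subspace containing `range ι`, `e` and `f` is
  everything, and the RANK GAIN of the exchange: if `w ∉ U ∋ y` (`U ≤ ℚ^{2g}`) then any subspace
  containing `ι U`, `f`, `e + ι c + s ι w` and `ι y - t (e + ι c)` (`s t ≠ 0`) has rank at least
  `rank U + 3` (three successive `LinearIndependent.finCons`, tested with the two new coordinate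
  functionals and with `w ∉ U`).
Pure algebra; NOTHING geometric is asserted here.
-/

noncomputable section

namespace Literature.GroupTheory.CombinatorialGroupTheory.SignedHurwitz

/-! ## §1 From integral to rational spans -/

section RatSpan

variable {ι : Type*}

/-- If `x` lies in the `ℤ`-span of `S ⊆ ℤ^ι`, its rational image lies in the `ℚ`-span of the
rational images of `S`. [folklore] -/
theorem ratCast_mem_span {S : Set (ι → ℤ)} {x : ι → ℤ} (h : x ∈ Submodule.span ℤ S) :
    (fun i => (x i : ℚ)) ∈ Submodule.span ℚ ((fun (v : ι → ℤ) (i : ι) => (v i : ℚ)) '' S) := by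
  let ρ : (ι → ℤ) →ₗ[ℤ] (ι → ℚ) :=
    { toFun := fun v i => (v i : ℚ)
      map_add' := fun v w => funext fun i => by simp
      map_smul' := fun c v => funext fun i => by simp }
  have hle : Submodule.map ρ (Submodule.span ℤ S) ≤
      (Submodule.span ℚ ((fun (v : ι → ℤ) (i : ι) => (v i : ℚ)) '' S)).restrictScalars ℤ := by
    rw [Submodule.map_span]
    exact Submodule.span_le_restrictScalars ℤ ℚ _
  exact hle (Submodule.mem_map_of_mem h)

/-- Monotonicity of rational spans along integral spans. [folklore] -/
theorem span_ratCast_mono {S T : Set (ι → ℤ)} (h : S ⊆ Submodule.span ℤ T) :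
    Submodule.span ℚ ((fun (v : ι → ℤ) (i : ι) => (v i : ℚ)) '' S) ≤
      Submodule.span ℚ ((fun (v : ι → ℤ) (i : ι) => (v i : ℚ)) '' T) := by
  rw [Submodule.span_le]
  rintro _ ⟨x, hx, rfl⟩
  exact ratCast_mem_span (h hx)

end RatSpan

/-! ## §2 The standard symplectic lattice over `ℤ` -/

section StdSympInt

variable (g : ℕ)

/-- `stdSymp ℤ g` is alternating. [folklore] -/
theorem stdSymp_int_self (x : Fin g ⊕ Fin g → ℤ) : stdSymp ℤ g x x = 0 := by
  simp [stdSymp_int_apply, mul_comm]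

/-- `stdSymp ℤ g` is skew-symmetric. [folklore] -/
theorem stdSymp_int_swap (x y : Fin g ⊕ Fin g → ℤ) : stdSymp ℤ g x y = -stdSymp ℤ g y x := by
  have h := stdSymp_int_self g (x + y)
  simp only [map_add, LinearMap.add_apply, stdSymp_int_self, zero_add, add_zero] at h
  linear_combination h

/-- `ω(eᵢ, x) = x_{g+i}`. [folklore] -/
theorem stdSymp_int_single_inl (i : Fin g) (x : Fin g ⊕ Fin g → ℤ) :
    stdSymp ℤ g (Pi.single (Sum.inl i) 1) x = x (Sum.inr i) := by
  simp [stdSymp_int_apply, Pi.single_apply]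

/-- `ω(fᵢ, x) = -xᵢ`. [folklore] -/
theorem stdSymp_int_single_inr (i : Fin g) (x : Fin g ⊕ Fin g → ℤ) :
    stdSymp ℤ g (Pi.single (Sum.inr i) 1) x = -x (Sum.inl i) := by
  simp [stdSymp_int_apply, Pi.single_apply]

/-- A non-zero vector pairs non-trivially with some coordinate vector. [folklore] -/
theorem exists_stdSymp_single_ne {x : Fin g ⊕ Fin g → ℤ} (hx : x ≠ 0) :
    ∃ k : Fin g ⊕ Fin g, stdSymp ℤ g (Pi.single k 1) x ≠ 0 := by
  obtain ⟨k, hk⟩ : ∃ k, x k ≠ 0 := not_forall.1 fun h => hx (funext h)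
  rcases k with i | i
  · exact ⟨Sum.inr i, by simpa [stdSymp_int_single_inr] using hk⟩
  · exact ⟨Sum.inl i, by simpa [stdSymp_int_single_inl] using hk⟩

/-- An integer vector with a coordinate equal to `1` is primitive. [folklore] -/
theorem isPrimitive_of_apply_eq_one {ι : Type*} {c : ι → ℤ} {k : ι} (h : c k = 1) :
    IsPrimitive c :=
  fun _ hd => isUnit_of_dvd_one (h ▸ hd k)

/-- For two non-zero vectors `x, y ∈ ℤ^{2g}` there is a PRIMITIVE `c` (a coordinate vector or a
sum of two distinct ones) with `ω(c, x) ≠ 0` and `ω(c, y) ≠ 0`. [folklore] -/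
theorem exists_isPrimitive_stdSymp_ne {x y : Fin g ⊕ Fin g → ℤ} (hx : x ≠ 0) (hy : y ≠ 0) :
    ∃ c : Fin g ⊕ Fin g → ℤ, IsPrimitive c ∧ stdSymp ℤ g c x ≠ 0 ∧ stdSymp ℤ g c y ≠ 0 := by
  classical
  obtain ⟨k₁, h₁⟩ := exists_stdSymp_single_ne g hx
  obtain ⟨k₂, h₂⟩ := exists_stdSymp_single_ne g hy
  rcases ne_or_eq (stdSymp ℤ g (Pi.single k₁ 1) y) 0 with h₁y | h₁y
  · exact ⟨_, isPrimitive_of_apply_eq_one (k := k₁) (by simp), h₁, h₁y⟩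
  rcases ne_or_eq (stdSymp ℤ g (Pi.single k₂ 1) x) 0 with h₂x | h₂x
  · exact ⟨_, isPrimitive_of_apply_eq_one (k := k₂) (by simp), h₂x, h₂⟩
  have hne : k₁ ≠ k₂ := by
    rintro rfl
    exact h₁ h₂x
  refine ⟨Pi.single k₁ 1 + Pi.single k₂ 1,
    isPrimitive_of_apply_eq_one (k := k₁) (by simp [Pi.single_eq_of_ne hne]), ?_, ?_⟩
  · rw [map_add, LinearMap.add_apply, h₂x, add_zero]
    exact h₁
  · rw [map_add, LinearMap.add_apply, h₁y, zero_add]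
    exact h₂

end StdSympInt

/-! ## §3 The exchange move -/

section Exchange

variable (g : ℕ)

/-- THE EXCHANGE.  From `A ++ w :: y :: C`: the stabilisation-pair move at the cut
`A ++ [w] ‖ y :: C` with arc class `c` (inserting `(e+c)⁺ f⁺ f⁻ (e+c)⁻`), then the Hurwitz move
on the pair `w, (e+c)⁺` that keeps `w` (it turns `(e+c)⁺` into `(e + c + ε_w ω(w,c) w)⁺`), then
the Hurwitz move on the pair `(e+c)⁻, y` that keeps `(e+c)⁻` (it turns `y` into
`(y - ω(c,y)(e+c))` with the sign of `y`).  The result is reachable. [folklore] -/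
theorem reach_exchange (A C : IntWord g) (w y : (Fin g ⊕ Fin g → ℤ) × Bool)
    (c : Fin g ⊕ Fin g → ℤ) (hc : c = 0 ∨ IsPrimitive c) :
    Reach g (A ++ w :: y :: C) (g + 1)
      (mapWord (embed g) A ++
        (newE g + embed g c + (sgn w.2 * stdSymp ℤ g w.1 c) • embed g w.1, true) ::
        (embed g w.1, w.2) :: (newF g, true) :: (newF g, false) ::
        (embed g y.1 - stdSymp ℤ g c y.1 • (newE g + embed g c), y.2) ::
        (newE g + embed g c, false) :: mapWord (embed g) C) := by
  set u : Fin (g + 1) ⊕ Fin (g + 1) → ℤ := newE g + embed g c with hu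
  have hω₁ : stdSymp ℤ (g + 1) (embed g w.1) u = stdSymp ℤ g w.1 c := by
    simp [hu, map_add, stdSymp_embed_embed]
  have hω₂ : stdSymp ℤ (g + 1) u (embed g y.1) = stdSymp ℤ g c y.1 := by
    simp [hu, map_add, LinearMap.add_apply, stdSymp_embed_embed]
  have hstab : StabStep g (A ++ w :: y :: C)
      (mapWord (embed g) A ++ (embed g w.1, w.2) :: (u, true) :: (newF g, true) ::
        (newF g, false) :: (u, false) :: (embed g y.1, y.2) :: mapWord (embed g) C) :=
    ⟨A ++ [w], y :: C, c, hc, by simp, by simp [stabBlock, mapWord_append, hu]⟩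
  have hstep₁ : HurwitzStep (stdSymp ℤ (g + 1))
      (mapWord (embed g) A ++ (embed g w.1, w.2) :: (u, true) :: (newF g, true) ::
        (newF g, false) :: (u, false) :: (embed g y.1, y.2) :: mapWord (embed g) C)
      (mapWord (embed g) A ++ (u + (sgn w.2 * stdSymp ℤ g w.1 c) • embed g w.1, true) ::
        (embed g w.1, w.2) :: (newF g, true) :: (newF g, false) :: (u, false) ::
        (embed g y.1, y.2) :: mapWord (embed g) C) :=
    ⟨mapWord (embed g) A,
      (newF g, true) :: (newF g, false) :: (u, false) :: (embed g y.1, y.2) :: mapWord (embed g) C,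
      (embed g w.1, w.2), (u, true), rfl, Or.inl (by rw [hω₁])⟩
  have hstep₂ : HurwitzStep (stdSymp ℤ (g + 1))
      (mapWord (embed g) A ++ (u + (sgn w.2 * stdSymp ℤ g w.1 c) • embed g w.1, true) ::
        (embed g w.1, w.2) :: (newF g, true) :: (newF g, false) :: (u, false) ::
        (embed g y.1, y.2) :: mapWord (embed g) C)
      (mapWord (embed g) A ++ (u + (sgn w.2 * stdSymp ℤ g w.1 c) • embed g w.1, true) ::
        (embed g w.1, w.2) :: (newF g, true) :: (newF g, false) ::
        (embed g y.1 - stdSymp ℤ g c y.1 • u, y.2) :: (u, false) :: mapWord (embed g) C) :=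
    ⟨mapWord (embed g) A ++ [(u + (sgn w.2 * stdSymp ℤ g w.1 c) • embed g w.1, true),
        (embed g w.1, w.2), (newF g, true), (newF g, false)],
      mapWord (embed g) C, (u, false), (embed g y.1, y.2), by simp,
      Or.inl (by simp [hω₂, sub_eq_add_neg])⟩
  exact (hstab.reach.hurwitz hstep₁).hurwitz hstep₂

end Exchange

/-! ## §4 The rational genus-raising embedding -/

section RatEmbed

variable (g : ℕ)

/-- `Sum.map Fin.castSucc Fin.castSucc` is injective. [folklore] -/
theorem sumMap_castSucc_injective :
    Function.Injective (Sum.map (Fin.castSucc (n := g)) (Fin.castSucc (n := g))) :=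
  Sum.map_injective.2 ⟨Fin.castSucc_injective g, Fin.castSucc_injective g⟩

/-- The rational embedding (`Function.ExtendByZero.linearMap ℚ (Sum.map Fin.castSucc
Fin.castSucc) x = Function.extend _ x 0`) on an old `inl` coordinate. [folklore] -/
@[simp] theorem extend_castSucc_inl_castSucc (x : Fin g ⊕ Fin g → ℚ) (j : Fin g) :
    Function.extend (Sum.map (Fin.castSucc (n := g)) (Fin.castSucc (n := g))) x 0
      (Sum.inl j.castSucc) = x (Sum.inl j) := by
  simpa using (sumMap_castSucc_injective g).extend_apply x 0 (Sum.inl j)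

/-- The rational embedding on an old `inr` coordinate. [folklore] -/
@[simp] theorem extend_castSucc_inr_castSucc (x : Fin g ⊕ Fin g → ℚ) (j : Fin g) :
    Function.extend (Sum.map (Fin.castSucc (n := g)) (Fin.castSucc (n := g))) x 0
      (Sum.inr j.castSucc) = x (Sum.inr j) := by
  simpa using (sumMap_castSucc_injective g).extend_apply x 0 (Sum.inr j)

/-- The rational embedding vanishes on the new `inl` coordinate. [folklore] -/
@[simp] theorem extend_castSucc_inl_last (x : Fin g ⊕ Fin g → ℚ) :
    Function.extend (Sum.map (Fin.castSucc (n := g)) (Fin.castSucc (n := g))) x 0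
      (Sum.inl (Fin.last g)) = 0 := by
  rw [Function.extend_apply']
  · rfl
  · rintro ⟨a | a, ha⟩
    · simp [Fin.castSucc_ne_last] at ha
    · simp at ha

/-- The rational embedding vanishes on the new `inr` coordinate. [folklore] -/
@[simp] theorem extend_castSucc_inr_last (x : Fin g ⊕ Fin g → ℚ) :
    Function.extend (Sum.map (Fin.castSucc (n := g)) (Fin.castSucc (n := g))) x 0
      (Sum.inr (Fin.last g)) = 0 := by
  rw [Function.extend_apply']
  · rfl
  · rintro ⟨a | a, ha⟩
    · simp at ha
    · simp [Fin.castSucc_ne_last] at ha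

/-- The rational embedding of the rational image is the rational image of `embed`. [folklore] -/
theorem extendQ_ratCast (v : Fin g ⊕ Fin g → ℤ) :
    Function.ExtendByZero.linearMap ℚ (Sum.map (Fin.castSucc (n := g)) (Fin.castSucc (n := g)))
      (fun i => (v i : ℚ)) = fun i => (embed g v i : ℚ) := by
  ext i
  rcases i with i | i <;> induction i using Fin.lastCases <;> simp

/-- The rational embedding is injective. [folklore] -/
theorem extendQ_injective : Function.Injective
    (Function.ExtendByZero.linearMap ℚ (Sum.map (Fin.castSucc (n := g)) (Fin.castSucc (n := g)))) := by
  intro x y h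
  ext k
  rcases k with j | j
  · simpa using congrFun h (Sum.inl j.castSucc)
  · simpa using congrFun h (Sum.inr j.castSucc)

/-- Every rational vector of `ℚ^{2g+2}` decomposes along the old slots and the new pair
`e, f`. [folklore] -/
theorem exists_eq_extendQ_add (x : Fin (g + 1) ⊕ Fin (g + 1) → ℚ) :
    ∃ x₀ : Fin g ⊕ Fin g → ℚ, x =
      Function.ExtendByZero.linearMap ℚ (Sum.map (Fin.castSucc (n := g)) (Fin.castSucc (n := g)))
        x₀ + x (Sum.inl (Fin.last g)) • Pi.single (Sum.inl (Fin.last g)) 1 +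
        x (Sum.inr (Fin.last g)) • Pi.single (Sum.inr (Fin.last g)) 1 := by
  refine ⟨Sum.elim (fun j => x (Sum.inl j.castSucc)) (fun j => x (Sum.inr j.castSucc)), ?_⟩
  ext i
  rcases i with i | i <;> induction i using Fin.lastCases <;> simp [Fin.castSucc_ne_last]

/-- The rational image of `e`. [folklore] -/
theorem ratCast_newE : (fun i => (newE g i : ℚ)) = Pi.single (Sum.inl (Fin.last g)) 1 := by
  ext i
  by_cases h : i = Sum.inl (Fin.last g)
  · subst h; simp [newE]
  · simp [newE, Pi.single_eq_of_ne h]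

/-- The rational image of `f`. [folklore] -/
theorem ratCast_newF : (fun i => (newF g i : ℚ)) = Pi.single (Sum.inr (Fin.last g)) 1 := by
  ext i
  by_cases h : i = Sum.inr (Fin.last g)
  · subst h; simp [newF]
  · simp [newF, Pi.single_eq_of_ne h]

end RatEmbed

/-! ## §5 Two rank statements -/

section Rank

variable (g : ℕ)

/-- A subspace of `ℚ^{2g+2}` containing the old slots, `e` and `f` is everything. [folklore] -/
theorem eq_top_of_range_extendQ_le (S : Submodule ℚ (Fin (g + 1) ⊕ Fin (g + 1) → ℚ))
    (hι : LinearMap.range (Function.ExtendByZero.linearMap ℚ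
      (Sum.map (Fin.castSucc (n := g)) (Fin.castSucc (n := g)))) ≤ S)
    (hE : (Pi.single (Sum.inl (Fin.last g)) 1 : Fin (g + 1) ⊕ Fin (g + 1) → ℚ) ∈ S)
    (hF : (Pi.single (Sum.inr (Fin.last g)) 1 : Fin (g + 1) ⊕ Fin (g + 1) → ℚ) ∈ S) : S = ⊤ := by
  refine eq_top_iff.2 fun x _ => ?_
  obtain ⟨x₀, hx⟩ := exists_eq_extendQ_add g x
  rw [hx]
  exact add_mem (add_mem (hι (LinearMap.mem_range_self _ x₀)) (S.smul_mem _ hE)) (S.smul_mem _ hF)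

/-- RANK GAIN OF THE EXCHANGE.  Let `U ≤ ℚ^{2g}` with `w ∉ U ∋ y`, and let `U' ≤ ℚ^{2g+2}`
contain `ι U`, `f`, `e + ι c + s • ι w` and `ι y - t • (e + ι c)` with `s, t ≠ 0` (`ι` the
rational genus-raising embedding).  Then `rank U + 3 ≤ rank U'`: append to `ι` of a basis of `U`
the three vectors `e + ι c + s ι w` (new `e`-coordinate `1`), `ι y - t (e + ι c)` (a combination
`a (e + ι c + s ι w) + ι u` would force `a = -t` and `s t w ∈ U`) and `f` (new `f`-coordinate
`1`, which vanishes on all previous vectors). [folklore] -/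
theorem finrank_add_three_le (U : Submodule ℚ (Fin g ⊕ Fin g → ℚ))
    (U' : Submodule ℚ (Fin (g + 1) ⊕ Fin (g + 1) → ℚ)) (w y c : Fin g ⊕ Fin g → ℚ) (s t : ℚ)
    (hs : s ≠ 0) (ht : t ≠ 0) (hw : w ∉ U) (hy : y ∈ U)
    (hU : U.map (Function.ExtendByZero.linearMap ℚ
      (Sum.map (Fin.castSucc (n := g)) (Fin.castSucc (n := g)))) ≤ U')
    (hF : (Pi.single (Sum.inr (Fin.last g)) 1 : Fin (g + 1) ⊕ Fin (g + 1) → ℚ) ∈ U')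
    (hv₁ : Pi.single (Sum.inl (Fin.last g)) 1 + Function.ExtendByZero.linearMap ℚ
        (Sum.map (Fin.castSucc (n := g)) (Fin.castSucc (n := g))) c +
        s • Function.ExtendByZero.linearMap ℚ
          (Sum.map (Fin.castSucc (n := g)) (Fin.castSucc (n := g))) w ∈ U')
    (hv₃ : Function.ExtendByZero.linearMap ℚ
        (Sum.map (Fin.castSucc (n := g)) (Fin.castSucc (n := g))) y -
        t • (Pi.single (Sum.inl (Fin.last g)) 1 + Function.ExtendByZero.linearMap ℚ
          (Sum.map (Fin.castSucc (n := g)) (Fin.castSucc (n := g))) c) ∈ U') :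
    Module.finrank ℚ U + 3 ≤ Module.finrank ℚ U' := by
  set ι := Function.ExtendByZero.linearMap ℚ
    (Sum.map (Fin.castSucc (n := g)) (Fin.castSucc (n := g))) with hιdef
  set E : Fin (g + 1) ⊕ Fin (g + 1) → ℚ := Pi.single (Sum.inl (Fin.last g)) 1 with hE
  set F : Fin (g + 1) ⊕ Fin (g + 1) → ℚ := Pi.single (Sum.inr (Fin.last g)) 1 with hF'
  set v₁ := E + ι c + s • ι w with hv₁def
  set v₃ := ι y - t • (E + ι c) with hv₃def
  -- a basis of `U`, pushed into `ℚ^{2g+2}`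
  set k := Module.finrank ℚ U
  let bU := Module.finBasis ℚ U
  let f₀ : Fin k → (Fin (g + 1) ⊕ Fin (g + 1) → ℚ) := fun i => ι (bU i : Fin g ⊕ Fin g → ℚ)
  have hf₀ : LinearIndependent ℚ f₀ :=
    (bU.linearIndependent.map' U.subtype (Submodule.ker_subtype U)).map' ι
      (LinearMap.ker_eq_bot.2 (extendQ_injective g))
  have hf₀U : Submodule.span ℚ (Set.range f₀) ≤ U.map ι :=
    Submodule.span_le.2 (Set.range_subset_iff.2 fun i => Submodule.mem_map_of_mem (bU i).2)
  have hιE : ∀ x ∈ U.map ι, x (Sum.inl (Fin.last g)) = 0 := by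
    rintro _ ⟨x₀, -, rfl⟩
    simp [hιdef]
  have hE₁ : v₁ (Sum.inl (Fin.last g)) = 1 := by simp [hv₁def, hE, hιdef]
  have hE₃ : v₃ (Sum.inl (Fin.last g)) = -t := by simp [hv₃def, hE, hιdef]
  -- first extension: `v₁`
  have h₁ : v₁ ∉ Submodule.span ℚ (Set.range f₀) := fun h => by
    have := hιE _ (hf₀U h)
    rw [hE₁] at this
    exact one_ne_zero this
  have hf₁ : LinearIndependent ℚ (Fin.cons v₁ f₀) := hf₀.finCons h₁
  -- second extension: `v₃`
  have h₂ : v₃ ∉ Submodule.span ℚ (Set.range (Fin.cons v₁ f₀)) := fun h => by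
    rw [Fin.range_cons] at h
    obtain ⟨a, z, hz, he⟩ := Submodule.mem_span_insert.1 h
    obtain ⟨u, hu, rfl⟩ := hf₀U hz
    have ha : a = -t := by
      have := congrFun he (Sum.inl (Fin.last g))
      simp [hE₃, hE₁, hιdef] at this
      linarith
    subst ha
    -- compare the old slots: `y - u + (t * s) • w = 0`, so `w ∈ U`
    have key : ι (y - u + (t * s) • w) = 0 := by
      have e1 : v₃ = -t • v₁ + ι u := he
      simp only [hv₃def, hv₁def, map_add, map_sub, map_smul] at e1 ⊢
      linear_combination (norm := module) e1
    have hmem : y - u + (t * s) • w = 0 := extendQ_injective g (by rw [key, map_zero])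
    have hts : t * s ≠ 0 := mul_ne_zero ht hs
    have hsw : (t * s) • w = u - y := by
      rw [← sub_eq_zero, ← hmem]
      abel
    exact hw ((U.smul_mem_iff hts).1 (hsw ▸ sub_mem hu hy))
  have hf₂ : LinearIndependent ℚ (Fin.cons v₃ (Fin.cons v₁ f₀)) := hf₁.finCons h₂
  -- third extension: `F`
  have h₃ : F ∉ Submodule.span ℚ (Set.range (Fin.cons v₃ (Fin.cons v₁ f₀))) := fun h => by
    have hker : Submodule.span ℚ (Set.range (Fin.cons v₃ (Fin.cons v₁ f₀))) ≤
        LinearMap.ker (LinearMap.proj (Sum.inr (Fin.last g))) := by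
      refine Submodule.span_le.2 (Set.range_subset_iff.2 fun i => ?_)
      refine Fin.cases ?_ (fun i => ?_) i
      · simp [hv₃def, hE, hιdef]
      · refine Fin.cases ?_ (fun j => ?_) i
        · simp only [Fin.cons_succ, Fin.cons_zero]
          simp [hv₁def, hE, hιdef]
        · simp only [Fin.cons_succ]
          simp [f₀, hιdef]
    have := hker h
    simp [hF'] at this
  have hf₃ : LinearIndependent ℚ (Fin.cons F (Fin.cons v₃ (Fin.cons v₁ f₀))) := hf₂.finCons h₃
  -- all `k + 3` vectors lie in `U'`
  have hsub : ∀ i, (Fin.cons F (Fin.cons v₃ (Fin.cons v₁ f₀)) : Fin (k + 1 + 1 + 1) → _) i ∈ U' := by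
    intro i
    refine Fin.cases (by simpa only [Fin.cons_zero] using hF) (fun i => ?_) i
    refine Fin.cases (by simpa only [Fin.cons_succ, Fin.cons_zero] using hv₃) (fun i => ?_) i
    refine Fin.cases (by simpa only [Fin.cons_succ, Fin.cons_zero] using hv₁) (fun i => ?_) i
    simp only [Fin.cons_succ]
    exact hU (Submodule.mem_map_of_mem (bU i).2)
  have hcard := finrank_span_eq_card hf₃
  rw [Fintype.card_fin] at hcard
  have hle := Submodule.finrank_mono (Submodule.span_le.2 (Set.range_subset_iff.2 hsub))
  omega

end Rank

end Literature.GroupTheory.CombinatorialGroupTheory.SignedHurwitz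

end
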